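import Summits.HubbardSuperconductivity.HubbardSuperconductivity.Theorems.WindowInfraredBound.Negative.TwistedDWaveWeight
import Summits.HubbardSuperconductivity.HubbardSuperconductivity.Theorems.WindowGap.Negative.TwistCeiling
import Literature.Probability.LatticeModels.TorusGreenHeatKernel
import Literature.MathematicalPhysics.QuantumLattice.DWaveSourceProofs
import Literature.MathematicalPhysics.QuantumLattice.ApproximateEigenvectorLemmas

/-!
# Crux `WindowInfraredBound` (item `stmt-HubbardSuperconductivity-1089`), negative side:
# the Lieb–Schultz–Mattis twist of a vector — its energy and its pair weight at the window momentum

Lemmas for `…/Negative/NearGroundStates.lean` (with `d`-wave order, no `O(1)` energy window above the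
ground state can replace the ground-state hypothesis of the crux).  For the unit twists
`G_j = phaseGauge (twistGauge L (2πj))`, `j = ±1`, on the torus of side `L ≥ 3`:

* `norm_twistBondPhase_sub_one_le` — the horizontal bond phase is within `2π/L` of `1`:
  `‖conj χ_{jê₁}(±ê₁) − 1‖ ≤ 2π/L` (`norm_stdAddChar_sub_one_le`);
* `norm_pairField_single_dWave_le` — a single-bond pair field has operator norm `≤ √2 L²`;
* `re_pairFieldAt_twist_ge` — PAIR WEIGHT: `‖Δ_d(−2jê₁) (G_jψ)‖² ≥ ‖Δ_dψ‖²/2 − 32π²L²` for a unit `ψ`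
  (`Δ_d(−2jê₁) G_j = G_j Σ_e conj χ_{jê₁}(e) Δ_{d·1_e}(0)` by the landed bond covariance
  `conjTranspose_twist_mul_pairFieldAt_single_mul`; only the two horizontal bonds are dephased);
* `exists_twist_energy_le` — ENERGY: for one of `j = ±1` (chosen against the current of `ψ`),
  `Re ⟨G_jψ, H G_jψ⟩ ≤ Re ⟨ψ, Hψ⟩ + 8π²`, `H = hubbardTorus 2 L 1 U` (integer flux quanta are a gauge:
  `phaseGauge_conj_hubbardTorus_add_smul`, `re_star_dotProduct_magneticHubbardTorus_uniformTwistConfig_mulVec`,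
  `|K₁| ≤ 2L²` from `WindowGap.Negative.abs_kineticWeight_le`, `1 − cos x ≤ x²/2`).

No definitions, no named facts.  Sources: E. Lieb, T. Schultz, D. Mattis, Ann. Phys. 16 (1961) 407;
H. Watanabe, J. Stat. Phys. 177 (2019) 717, §2.2.1; H. Tasaki (2020) §2.1; D. J. Scalapino, Phys. Rep. 250
(1995) 329, §2.
-/

-- the mandated namespace `Summit.<Summit>.<Problem>.Theorems` repeats `HubbardSuperconductivity`
-- (single-problem summit, D-0017), which the `dupNamespace` linter flags on every declaration
set_option linter.dupNamespace false

noncomputable section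

namespace Summit.HubbardSuperconductivity.HubbardSuperconductivity.Theorems.WindowInfraredBound.Negative

open Literature.MathematicalPhysics.QuantumLattice Literature.MathematicalPhysics.QuantumFieldTheory
  Literature.Probability.LatticeModels Matrix Finset
open Summit.HubbardSuperconductivity.HubbardSuperconductivity.Theorems.WindowGap.Negative (abs_kineticWeight_le)
open scoped Matrix.Norms.L2Operator ComplexOrder ComplexConjugate

section Twist

variable {L : ℕ} [NeZero L]

/-! ### The horizontal bond phases of the unit twists -/

/-- `‖conj z − 1‖ = ‖z − 1‖`. [folklore] -/
theorem norm_conj_sub_one (z : ℂ) : ‖conj z - 1‖ = ‖z - 1‖ := by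
  rw [← Complex.norm_conj (z - 1), map_sub, map_one]

omit [NeZero L] in
/-- The unit step `ê₁` reduced mod `L` is the unit step of `(ℤ/Lℤ)²`. [folklore] -/
theorem proj_single_zero_one :
    Torus.proj L (Pi.single 0 1 : Site 2) = (Pi.single 0 1 : TorusSite 2 L) := by
  funext l
  by_cases h : l = 0
  · subst h; simp [Torus.proj]
  · simp [Torus.proj, h]

/-- **The unit-twist bond phase is within `2π/L` of `1`**: for `L ≥ 3`, `j = ±1` and the horizontal
steps `±ê₁`, `‖conj χ_{jê₁}(±ê₁) − 1‖ ≤ 2π/L` (`|e^{iθ} − 1| ≤ |θ|`, `norm_stdAddChar_sub_one_le`). [folklore] -/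
theorem norm_twistBondPhase_sub_one_le (hL : 3 ≤ L) {j : ℤ} (hj : j = 1 ∨ j = -1) (s : ℤˣ) :
    ‖conj (torusChar (Pi.single 0 ((j : ℤ) : ZMod L) : TorusSite 2 L)
        (Torus.proj L ((s : ℤ) • (Pi.single 0 1 : Site 2)))) - 1‖ ≤ 2 * Real.pi / L := by
  -- the basic phase `w = e(1/L)`
  have hkey : ‖(ZMod.stdAddChar (1 : ZMod L) : ℂ) - 1‖ ≤ 2 * Real.pi / L := by
    have h := norm_stdAddChar_sub_one_le (L := L) (1 : ZMod L)
    have hv : (1 : ZMod L).valMinAbs = 1 := by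
      have h1 : ((1 : ℕ) : ZMod L).valMinAbs = (1 : ℕ) :=
        ZMod.valMinAbs_natCast_of_le_half (by omega)
      simpa using h1
    rw [hv, Int.cast_one, mul_one, abs_of_nonneg (by positivity)] at h
    exact h
  -- `χ_{jê₁}(ê₁) = e(j/L)`, which is `w` or `conj w`
  have hchar : torusChar (Pi.single 0 ((j : ℤ) : ZMod L) : TorusSite 2 L) (Torus.proj L (Pi.single 0 1)) =
      (ZMod.stdAddChar ((j : ℤ) : ZMod L) : ℂ) := by
    rw [proj_single_zero_one, torusChar_single_eq_stdAddChar, Pi.single_eq_same]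
  have hw : ‖(ZMod.stdAddChar ((j : ℤ) : ZMod L) : ℂ) - 1‖ ≤ 2 * Real.pi / L := by
    rcases hj with rfl | rfl
    · rw [Int.cast_one]; exact hkey
    · rw [Int.cast_neg, Int.cast_one, AddChar.map_neg_eq_conj, norm_conj_sub_one]; exact hkey
  rcases Int.units_eq_one_or s with rfl | rfl
  · rw [Units.val_one, one_smul, hchar, norm_conj_sub_one]
    exact hw
  · have hneg : Torus.proj L (((-1 : ℤˣ) : ℤ) • (Pi.single 0 1 : Site 2)) =
        -Torus.proj L (Pi.single 0 1) := by
      rw [Units.val_neg, Units.val_one, neg_smul, one_smul]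
      funext i
      simp [Torus.proj]
    rw [hneg, torusChar_neg_right, hchar, Complex.conj_conj]
    exact hw

/-! ### Single-bond pair fields are `O(L²)` in operator norm -/

/-- **`‖Δ_{d·1_e}(0)‖ ≤ √2 L²`**: a single-bond pair field is a sum of `L²` local pairs of norm
`≤ 2|d(e)|/√2 ≤ √2`. [folklore] -/
theorem norm_pairField_single_dWave_le (e : Site 2) :
    ‖pairField (Pi.single e (dWaveFormFactor e)) L‖ ≤ Real.sqrt 2 * (L : ℝ) ^ 2 := by
  have hs2 : (0 : ℝ) < Real.sqrt 2 := Real.sqrt_pos.2 two_pos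
  have hloc : ∀ x : TorusSite 2 L, ‖localPair (Pi.single e (dWaveFormFactor e)) L x‖ ≤ Real.sqrt 2 := by
    intro x
    refine (norm_localPair_le (Pi.single e (dWaveFormFactor e)) L x).trans ?_
    have hsum : ∑ e' ∈ insert (0 : Site 2) unitSteps,
        |(Pi.single e (dWaveFormFactor e) : Site 2 → ℝ) e' / Real.sqrt 2| ≤
          |dWaveFormFactor e / Real.sqrt 2| := by
      by_cases he : e ∈ insert (0 : Site 2) unitSteps
      · rw [Finset.sum_eq_single e (fun e' _ hne => by rw [Pi.single_eq_of_ne hne, zero_div, abs_zero])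
          (fun h => absurd he h), Pi.single_eq_same]
      · rw [Finset.sum_eq_zero (fun e' he' => by
          rw [Pi.single_eq_of_ne (ne_of_mem_of_not_mem he' he), zero_div, abs_zero])]
        exact abs_nonneg _
    -- `|d(e)| ≤ 1` (as in `Theorems.abs_dWaveFormFactor_le_one` of the ThermalWedge reduction, not imported here)
    have habs : |dWaveFormFactor e| ≤ 1 := by
      unfold dWaveFormFactor
      split_ifs <;> norm_num
    have hd : |dWaveFormFactor e / Real.sqrt 2| ≤ 1 / Real.sqrt 2 := by
      rw [abs_div, abs_of_pos hs2]
      exact div_le_div_of_nonneg_right habs hs2.le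
    have hsq : 2 * (1 / Real.sqrt 2) = Real.sqrt 2 := by
      rw [mul_one_div, Real.div_sqrt]
    nlinarith
  calc ‖pairField (Pi.single e (dWaveFormFactor e)) L‖
      ≤ ∑ x : TorusSite 2 L, ‖localPair (Pi.single e (dWaveFormFactor e)) L x‖ := norm_sum_le _ _
    _ ≤ ∑ _x : TorusSite 2 L, Real.sqrt 2 := Finset.sum_le_sum fun x _ => hloc x
    _ = Real.sqrt 2 * (L : ℝ) ^ 2 := by
        rw [Finset.sum_const, Finset.card_univ, Fintype.card_fun, Fintype.card_fin, ZMod.card,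
          nsmul_eq_mul]
        push_cast
        ring

/-! ### The pair weight of a twisted vector at the window momentum -/

/-- **The twist carries the condensate to the window momentum, up to `O(L)`.** For `L ≥ 3`, `j = ±1`
and a unit vector `ψ`: `‖Δ_d(−2jê₁) (G_j ψ)‖² ≥ ‖Δ_d ψ‖²/2 − 32π² L²` (in the tree's `Re ⟨v, v⟩` form).
Indeed `Δ_d(−2jê₁) G_j = G_j (Δ_d + R)` with `R = Σ_{e = ±ê₁} (conj χ_{jê₁}(e) − 1) Δ_{d·1_e}(0)`,
`‖Rψ‖ ≤ 2 · (2π/L) · √2L² = 4√2πL`, and `‖x + y‖² ≥ ‖x‖²/2 − ‖y‖²`.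
Watanabe, J. Stat. Phys. 177 (2019) 717, §2.2.1; Scalapino, Phys. Rep. 250 (1995) 329, §2. [folklore] -/
theorem re_pairFieldAt_twist_ge (hL : 3 ≤ L) {j : ℤ} (hj : j = 1 ∨ j = -1)
    {ψ : Fock (Orb (FermionTorus 2 L))} (hψ : star ψ ⬝ᵥ ψ = 1) :
    (star (pairField dWaveFormFactor L *ᵥ ψ) ⬝ᵥ (pairField dWaveFormFactor L *ᵥ ψ)).re / 2 -
        32 * Real.pi ^ 2 * (L : ℝ) ^ 2 ≤
      (star (pairFieldAt dWaveFormFactor L (-(Pi.single 0 (((2 * j : ℤ)) : ZMod L))) *ᵥ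
          (phaseGauge (fun u : FermionTorus 2 L => twistGauge L (j * (2 * Real.pi)) u.toTorusSite) *ᵥ ψ)) ⬝ᵥ
        (pairFieldAt dWaveFormFactor L (-(Pi.single 0 (((2 * j : ℤ)) : ZMod L))) *ᵥ
          (phaseGauge (fun u : FermionTorus 2 L => twistGauge L (j * (2 * Real.pi)) u.toTorusSite) *ᵥ ψ))).re := by
  -- the conjugated pair field, bond by bond, at momentum `0`
  have hconj : (phaseGauge (fun u : FermionTorus 2 L => twistGauge L (j * (2 * Real.pi)) u.toTorusSite))ᴴ *
        pairFieldAt dWaveFormFactor L (-(Pi.single 0 (((2 * j : ℤ)) : ZMod L))) *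
        phaseGauge (fun u : FermionTorus 2 L => twistGauge L (j * (2 * Real.pi)) u.toTorusSite) =
      ∑ e ∈ insert (0 : Site 2) unitSteps,
        conj (torusChar (Pi.single 0 ((j : ℤ) : ZMod L) : TorusSite 2 L) (Torus.proj L e)) •
          pairField (Pi.single e (dWaveFormFactor e)) L := by
    rw [pairFieldAt_eq_sum_single dWaveFormFactor, Finset.mul_sum, Finset.sum_mul]
    refine Finset.sum_congr rfl fun e he => ?_
    rw [conjTranspose_twist_mul_pairFieldAt_single_mul dWaveFormFactor he j, neg_add_cancel, pairFieldAt_zero]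
  -- `Δ (G ψ) = G (v)`, `v = Σ_e u_e Δ_e ψ`, and `G` is an isometry
  rw [mulVec_phaseGauge_mulVec, hconj,
    star_mulVec_dotProduct_self_of_unitary (conjTranspose_phaseGauge_mulVec_phaseGauge_mulVec _)]
  -- split `v = x + y`
  obtain ⟨x, hx⟩ : ∃ x : Fock (Orb (FermionTorus 2 L)), x = pairField dWaveFormFactor L *ᵥ ψ := ⟨_, rfl⟩
  obtain ⟨y, hy⟩ : ∃ y : Fock (Orb (FermionTorus 2 L)), y = ∑ e ∈ insert (0 : Site 2) unitSteps,
      (conj (torusChar (Pi.single 0 ((j : ℤ) : ZMod L) : TorusSite 2 L) (Torus.proj L e)) - 1) •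
        (pairField (Pi.single e (dWaveFormFactor e)) L *ᵥ ψ) := ⟨_, rfl⟩
  have hv : (∑ e ∈ insert (0 : Site 2) unitSteps,
      conj (torusChar (Pi.single 0 ((j : ℤ) : ZMod L) : TorusSite 2 L) (Torus.proj L e)) •
        pairField (Pi.single e (dWaveFormFactor e)) L) *ᵥ ψ = x + y := by
    have hxsum : x = ∑ e ∈ insert (0 : Site 2) unitSteps,
        pairField (Pi.single e (dWaveFormFactor e)) L *ᵥ ψ := by
      rw [hx, ← sum_mulVec, ← pairFieldAt_zero, pairFieldAt_eq_sum_single dWaveFormFactor 0]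
      simp only [pairFieldAt_zero]
    rw [hxsum, hy, ← Finset.sum_add_distrib, sum_mulVec]
    refine Finset.sum_congr rfl fun e _ => ?_
    rw [smul_mulVec, sub_smul, one_smul, add_sub_cancel]
  rw [hv, ← hx]
  -- the size of `y`: only the two horizontal bonds survive, each `≤ (2π/L) · √2 L²`
  have hψ1 : eucNorm ψ = 1 := by
    have h := eucNorm_sq ψ
    rw [hψ, Complex.one_re] at h
    nlinarith [eucNorm_nonneg ψ]
  have hterm : ∀ e : Site 2,
      eucNorm ((conj (torusChar (Pi.single 0 ((j : ℤ) : ZMod L) : TorusSite 2 L) (Torus.proj L e)) - 1) •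
        (pairField (Pi.single e (dWaveFormFactor e)) L *ᵥ ψ)) ≤
        ‖conj (torusChar (Pi.single 0 ((j : ℤ) : ZMod L) : TorusSite 2 L) (Torus.proj L e)) - 1‖ *
          (Real.sqrt 2 * (L : ℝ) ^ 2) := by
    intro e
    rw [eucNorm_smul]
    refine mul_le_mul_of_nonneg_left ?_ (norm_nonneg _)
    calc eucNorm (pairField (Pi.single e (dWaveFormFactor e)) L *ᵥ ψ)
        ≤ ‖pairField (Pi.single e (dWaveFormFactor e)) L‖ * eucNorm ψ := eucNorm_mulVec_le _ _
      _ ≤ Real.sqrt 2 * (L : ℝ) ^ 2 * eucNorm ψ :=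
          mul_le_mul_of_nonneg_right (norm_pairField_single_dWave_le e) (eucNorm_nonneg _)
      _ = Real.sqrt 2 * (L : ℝ) ^ 2 := by rw [hψ1, mul_one]
  -- the phases at `0` and `±ê₂` are `1`
  have hu0 : conj (torusChar (Pi.single 0 ((j : ℤ) : ZMod L) : TorusSite 2 L) (Torus.proj L 0)) - 1 = 0 := by
    have : Torus.proj L (0 : Site 2) = 0 := by funext i; simp [Torus.proj]
    rw [this, torusChar_zero_right, map_one, sub_self]
  have hv1 := torusChar_single_zero_proj_snd (L := L) ((j : ℤ) : ZMod L) 1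
  have hv2 := torusChar_single_zero_proj_snd (L := L) ((j : ℤ) : ZMod L) (-1)
  simp only [Units.val_one, one_smul, Units.val_neg, neg_smul] at hv1 hv2
  have hb1 := norm_twistBondPhase_sub_one_le hL hj 1
  have hb2 := norm_twistBondPhase_sub_one_le hL hj (-1)
  simp only [Units.val_one, one_smul, Units.val_neg, neg_smul] at hb1 hb2
  have hLpos : (0 : ℝ) < L := by exact_mod_cast (show 0 < L by omega)
  have hynorm : eucNorm y ≤ 4 * Real.sqrt 2 * Real.pi * L := by
    rw [hy, sum_insert_zero_unitSteps_expand, hu0, zero_smul, zero_add, hv1, hv2, map_one, sub_self,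
      zero_smul, zero_smul]
    simp only [add_zero]
    refine (eucNorm_add_le _ _).trans ?_
    have h1 := (hterm (Pi.single 0 1)).trans (mul_le_mul_of_nonneg_right hb1 (by positivity))
    have h2 := (hterm (-Pi.single 0 1)).trans (mul_le_mul_of_nonneg_right hb2 (by positivity))
    have hcalc : 2 * Real.pi / L * (Real.sqrt 2 * (L : ℝ) ^ 2) = 2 * Real.sqrt 2 * Real.pi * L := by
      field_simp
    rw [hcalc] at h1 h2
    linarith
  -- `‖x + y‖² ≥ ‖x‖²/2 − ‖y‖²`
  have hxle : eucNorm x ≤ eucNorm (x + y) + eucNorm y := by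
    have h := eucNorm_sub_le (x + y) y
    rwa [add_sub_cancel_right] at h
  have hsqrt2 : Real.sqrt 2 ^ 2 = 2 := Real.sq_sqrt zero_le_two
  have hy2 : eucNorm y ^ 2 ≤ 32 * Real.pi ^ 2 * (L : ℝ) ^ 2 := by
    have h := pow_le_pow_left₀ (eucNorm_nonneg y) hynorm 2
    have h' : (4 * Real.sqrt 2 * Real.pi * (L : ℝ)) ^ 2 = 32 * Real.pi ^ 2 * (L : ℝ) ^ 2 := by
      have h16 : (4 * Real.sqrt 2 * Real.pi * (L : ℝ)) ^ 2 =
          16 * Real.sqrt 2 ^ 2 * Real.pi ^ 2 * (L : ℝ) ^ 2 := by ring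
      rw [h16, hsqrt2]
      ring
    linarith
  have hx2 : eucNorm x ^ 2 ≤ 2 * eucNorm (x + y) ^ 2 + 2 * eucNorm y ^ 2 := by
    nlinarith [hxle, eucNorm_nonneg x, eucNorm_nonneg y, eucNorm_nonneg (x + y),
      sq_nonneg (eucNorm (x + y) - eucNorm y), mul_self_le_mul_self (eucNorm_nonneg x) hxle]
  rw [← eucNorm_sq, ← eucNorm_sq]
  linarith

/-! ### The energy of a twisted ground state -/

/-- **A unit twist costs at most `8π²`, for the right sign of the winding.** For `L ≥ 3` and a unit
Fock vector `ψ` there is `j ∈ {1, −1}` with `Re ⟨G_jψ, H G_jψ⟩ ≤ Re ⟨ψ, Hψ⟩ + 8π²`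
(`H = hubbardTorus 2 L 1 U`): `G_jᴴ H G_j` is the uniformly twisted Peierls torus (integer flux quanta
are a gauge, `phaseGauge_conj_hubbardTorus_add_smul`), whose energy in `ψ` is
`Re ⟨ψ,Hψ⟩ + 2(1 − cos(2πj/L)) K₁(ψ) + 2 sin(2πj/L) J₁(ψ)`
(`re_star_dotProduct_magneticHubbardTorus_uniformTwistConfig_mulVec`); the sign of `j` is chosen against
the current `J₁(ψ)`, and `|K₁| ≤ 2L²` (`WindowGap.Negative.abs_kineticWeight_le`), `1 − cos x ≤ x²/2`.
Lieb–Schultz–Mattis, Ann. Phys. 16 (1961) 407; Watanabe (2019) §2.2.1; Tasaki (2020) §2.1. [folklore] -/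
theorem exists_twist_energy_le (hL : 3 ≤ L) (U : ℝ) {ψ : Fock (Orb (FermionTorus 2 L))}
    (hψ : star ψ ⬝ᵥ ψ = 1) :
    ∃ j : ℤ, (j = 1 ∨ j = -1) ∧
      (star (phaseGauge (fun u : FermionTorus 2 L => twistGauge L (j * (2 * Real.pi)) u.toTorusSite) *ᵥ ψ) ⬝ᵥ
          (hubbardTorus 2 L 1 U *ᵥ
            (phaseGauge (fun u : FermionTorus 2 L => twistGauge L (j * (2 * Real.pi)) u.toTorusSite) *ᵥ ψ))).re ≤
        (star ψ ⬝ᵥ (hubbardTorus 2 L 1 U *ᵥ ψ)).re + 8 * Real.pi ^ 2 := by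
  -- the energy of the twisted vector, for every winding
  have hE : ∀ j : ℤ,
      (star (phaseGauge (fun u : FermionTorus 2 L => twistGauge L (j * (2 * Real.pi)) u.toTorusSite) *ᵥ ψ) ⬝ᵥ
          (hubbardTorus 2 L 1 U *ᵥ
            (phaseGauge (fun u : FermionTorus 2 L => twistGauge L (j * (2 * Real.pi)) u.toTorusSite) *ᵥ ψ))).re =
        (star ψ ⬝ᵥ (hubbardTorus 2 L 1 U *ᵥ ψ)).re +
          2 * (1 - Real.cos (j * (2 * Real.pi) / L)) *
            (∑ x : Site 2 L, ∑ σ : Fin 2,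
              (star ψ ⬝ᵥ ((creation (orb (FermionTorus.ofTorusSite (Site.shift x 0)) σ) *
                annihilation (orb (FermionTorus.ofTorusSite x) σ)) *ᵥ ψ)).re) +
          2 * Real.sin (j * (2 * Real.pi) / L) *
            (∑ x : Site 2 L, ∑ σ : Fin 2,
              (star ψ ⬝ᵥ ((creation (orb (FermionTorus.ofTorusSite (Site.shift x 0)) σ) *
                annihilation (orb (FermionTorus.ofTorusSite x) σ)) *ᵥ ψ)).im) := by
    intro j
    have hconj := phaseGauge_conj_hubbardTorus_add_smul hL U 0 0 j
    rw [Complex.ofReal_zero, zero_smul, add_zero, zero_smul, add_zero] at hconj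
    rw [← re_star_dotProduct_conjTranspose_mul_mul_mulVec, hconj,
      re_star_dotProduct_magneticHubbardTorus_uniformTwistConfig_mulVec,
      magneticHubbardTorus_one_eq_hubbardTorus hL]
  have hK := abs_kineticWeight_le (L := L) hψ
  obtain ⟨K₁, hK₁⟩ : ∃ K₁ : ℝ, K₁ = ∑ x : Site 2 L, ∑ σ : Fin 2,
      (star ψ ⬝ᵥ ((creation (orb (FermionTorus.ofTorusSite (Site.shift x 0)) σ) *
        annihilation (orb (FermionTorus.ofTorusSite x) σ)) *ᵥ ψ)).re := ⟨_, rfl⟩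
  obtain ⟨J₁, hJ₁⟩ : ∃ J₁ : ℝ, J₁ = ∑ x : Site 2 L, ∑ σ : Fin 2,
      (star ψ ⬝ᵥ ((creation (orb (FermionTorus.ofTorusSite (Site.shift x 0)) σ) *
        annihilation (orb (FermionTorus.ofTorusSite x) σ)) *ᵥ ψ)).im := ⟨_, rfl⟩
  rw [← hK₁] at hK
  simp_rw [← hK₁, ← hJ₁] at hE
  have hLpos : (0 : ℝ) < L := by exact_mod_cast (show 0 < L by omega)
  have hL3 : (3 : ℝ) ≤ L := by exact_mod_cast hL
  -- the cosine cost `2(1 − cos(2π/L))·K₁ ≤ 8π²`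
  have hcos : 2 * (1 - Real.cos (2 * Real.pi / L)) * K₁ ≤ 8 * Real.pi ^ 2 := by
    have h1 : 0 ≤ 1 - Real.cos (2 * Real.pi / L) := by linarith [Real.cos_le_one (2 * Real.pi / L)]
    have h2 : 1 - Real.cos (2 * Real.pi / L) ≤ (2 * Real.pi / L) ^ 2 / 2 := by
      linarith [Real.one_sub_sq_div_two_le_cos (x := 2 * Real.pi / L)]
    have h3 : K₁ ≤ 2 * (L : ℝ) ^ 2 := (le_abs_self _).trans hK
    have h4 : (2 * Real.pi / L) ^ 2 / 2 * (2 * (L : ℝ) ^ 2) = 4 * Real.pi ^ 2 := by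
      field_simp
      ring
    calc 2 * (1 - Real.cos (2 * Real.pi / L)) * K₁
        ≤ 2 * (1 - Real.cos (2 * Real.pi / L)) * (2 * (L : ℝ) ^ 2) :=
          mul_le_mul_of_nonneg_left h3 (by positivity)
      _ ≤ 2 * ((2 * Real.pi / L) ^ 2 / 2) * (2 * (L : ℝ) ^ 2) :=
          mul_le_mul_of_nonneg_right (mul_le_mul_of_nonneg_left h2 (by norm_num)) (by positivity)
      _ = 8 * Real.pi ^ 2 := by rw [mul_assoc, h4]; ring
  have hsin : 0 ≤ Real.sin (2 * Real.pi / L) := by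
    refine Real.sin_nonneg_of_nonneg_of_le_pi (by positivity) ?_
    rw [div_le_iff₀ hLpos]
    nlinarith [Real.pi_pos]
  by_cases hJ : 0 ≤ J₁
  · refine ⟨-1, Or.inr rfl, ?_⟩
    rw [hE (-1)]
    have hc : Real.cos (((-1 : ℤ) : ℝ) * (2 * Real.pi) / L) = Real.cos (2 * Real.pi / L) := by
      rw [show ((-1 : ℤ) : ℝ) * (2 * Real.pi) / L = -(2 * Real.pi / L) by push_cast; ring, Real.cos_neg]
    have hs : Real.sin (((-1 : ℤ) : ℝ) * (2 * Real.pi) / L) = -Real.sin (2 * Real.pi / L) := by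
      rw [show ((-1 : ℤ) : ℝ) * (2 * Real.pi) / L = -(2 * Real.pi / L) by push_cast; ring, Real.sin_neg]
    rw [hc, hs]
    nlinarith [mul_nonneg hsin hJ]
  · refine ⟨1, Or.inl rfl, ?_⟩
    rw [hE 1]
    have hc : Real.cos (((1 : ℤ) : ℝ) * (2 * Real.pi) / L) = Real.cos (2 * Real.pi / L) := by
      rw [show ((1 : ℤ) : ℝ) * (2 * Real.pi) / L = 2 * Real.pi / L by push_cast; ring]
    have hs : Real.sin (((1 : ℤ) : ℝ) * (2 * Real.pi) / L) = Real.sin (2 * Real.pi / L) := by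
      rw [show ((1 : ℤ) : ℝ) * (2 * Real.pi) / L = 2 * Real.pi / L by push_cast; ring]
    rw [hc, hs]
    nlinarith [mul_nonpos_of_nonneg_of_nonpos hsin (le_of_lt (not_le.1 hJ))]

end Twist

end Summit.HubbardSuperconductivity.HubbardSuperconductivity.Theorems.WindowInfraredBound.Negative
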